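import Literature.AlgebraicGeometry.Resolution.CentresAndCoordinates
import Literature.AlgebraicGeometry.Motives.SegreEmbeddingPoints

/-!
# Route RisoStrata — crux `RisoGlobalisation`, line SketchIdeator1: the graph-closure model

For a projective model `M` of `K/k` with a closed `k`-immersion `ι_M : M ↪ ℙⁿ_k` and homogeneous
coordinates `w` of its generic point, and a vector `u ∈ Kᵐ⁺¹ ∖ 0`, the closure model
`P := ProjModel.ofClosure` of the `K`-point `(gen_M, [u])` of `M ×ₖ ℙᵐ_k` (the closure of the
graph of the rational map `M ⋯→ ℙᵐ` given by `u`) dominates `M` (`ProjModel.ofClosure.homOf` of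
the first projection) and, through `M ×ₖ ℙᵐ ↪ ℙⁿ ×ₖ ℙᵐ ↪ ℙⁿᵐ⁺ⁿ⁺ᵐ` (Segre), has homogeneous
coordinates `w ⊗ u` (tree `ProjectiveSpace.map_segreEmbedding_lift_pointOfVec`).
-/

-- single-problem summit: the doubled namespace component `ResolutionOfSingularities` is forced
set_option linter.dupNamespace false

namespace Summit.ResolutionOfSingularities.ResolutionOfSingularities.Theorems

open AlgebraicGeometry CategoryTheory
open Literature.AlgebraicGeometry.Resolution Literature.AlgebraicGeometry.Motives

attribute [local instance] MvPolynomial.gradedAlgebra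

universe u

variable {k K : Type u} [Field k] [Field K] [Algebra k K]

open MonoidalCategory CartesianMonoidalCategory in
/-- **The graph-closure model.**  For a projective model `M` of `K/k` with a closed
`k`-immersion `ι_M : M ↪ ℙⁿ_k` and homogeneous coordinates `w` of its generic point, and a
vector `u ∈ Kᵐ⁺¹ ∖ 0`, the closure model `P := ProjModel.ofClosure` of the `K`-point
`(gen_M, [u])` of `M ×ₖ ℙᵐ_k` dominates `M` (`ofClosure.homOf` of the first projection) and,
through `M ×ₖ ℙᵐ ↪ ℙⁿ ×ₖ ℙᵐ ↪ ℙⁿᵐ⁺ⁿ⁺ᵐ` (Segre), has homogeneous coordinates `w ⊗ u`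
(tree `ProjectiveSpace.map_segreEmbedding_lift_pointOfVec`). -/
theorem stub_graphModel (M : ProjModel k K) {n : ℕ}
    (ιM : M.X ⟶ Proj (Segre.grading (Fin (n + 1)) k)) [IsClosedImmersion ιM]
    (hιM : ιM ≫ Segre.toSpec (Fin (n + 1)) k = M.π) (w : Fin (n + 1) → K) (hw : w ≠ 0)
    (hgenM : M.gen ≫ ιM = (ProjectiveSpace.pointOfVec k w hw).left)
    {m : ℕ} (u : Fin (m + 1) → K) (hu : u ≠ 0) :
    ∃ (P : ProjModel k K) (_ : P.Hom M)
      (ιP : P.X ⟶ Proj (Segre.grading (Fin (n * m + n + m + 1)) k)) (_ : IsClosedImmersion ιP)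
      (_ : ιP ≫ Segre.toSpec (Fin (n * m + n + m + 1)) k = P.π),
      P.gen ≫ ιP = (ProjectiveSpace.pointOfVec k
        (fun t => w ((segreIndexEquiv n m).symm t).1 * u ((segreIndexEquiv n m).symm t).2)
        (ProjectiveSpace.segreVec_ne_zero hw hu)).left := by
  -- the ambient `Q := M ×ₖ ℙᵐ_k`, a projective `k`-scheme
  let PS : SchemeOver k := projectiveSpace m k
  let Q : SchemeOver k := M.toOver ⊗ PS
  have hPS : IsProjectiveOver PS :=
    ⟨m, 𝟙 _, by rw [Over.id_left]; infer_instance⟩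
  have hQ : IsProjectiveOver Q := M.isProjectiveOver.tensor hPS
  -- the `K`-point `(gen_M, [u])` of `Q`
  let gM : specOver k K ⟶ M.toOver := Over.homMk M.gen M.gen_π
  let pu : specOver k K ⟶ PS := ProjectiveSpace.pointOfVec k u hu
  let rlO : specOver k K ⟶ Q := lift gM pu
  let rl : Spec (CommRingCat.of K) ⟶ Q.left := rlO.left
  -- the first projection `Q → M`
  let s : Q.left ⟶ M.X := (fst M.toOver PS).left
  have hs : s ≫ M.π = Q.hom := Over.w (fst M.toOver PS)
  have hr : rl ≫ s = M.gen := by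
    show rlO.left ≫ (fst M.toOver PS).left = gM.left
    rw [← Over.comp_left, lift_fst]
  -- the closure model and its domination of `M`
  let P : ProjModel k K := ProjModel.ofClosure M hQ rl s hs hr
  let φ : P.Hom M := ProjModel.ofClosure.homOf M hQ rl s hs hr M s hs hr
  -- the embedding `P ↪ Q = M ×ₖ ℙᵐ ↪ ℙⁿ ×ₖ ℙᵐ ↪ ℙⁿᵐ⁺ⁿ⁺ᵐ`
  let ιMO : M.toOver ⟶ projectiveSpace n k := Over.homMk ιM hιM
  haveI : IsClosedImmersion ιMO.left := inferInstanceAs (IsClosedImmersion ιM)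
  haveI : IsClosedImmersion (𝟙 PS : PS ⟶ PS).left := by rw [Over.id_left]; infer_instance
  haveI : IsClosedImmersion (ιMO ⊗ₘ 𝟙 PS).left := isClosedImmersion_tensorHom_left ιMO (𝟙 PS)
  let ιP₀ : rl.image ⟶ (projectiveSpace (n * m + n + m) k).left :=
    rl.imageι ≫ (ιMO ⊗ₘ 𝟙 PS).left ≫ (segreEmbedding n m k).left
  have hιPci : IsClosedImmersion ιP₀ := inferInstance
  let ιP : P.X ⟶ Proj (Segre.grading (Fin (n * m + n + m + 1)) k) := ιP₀
  have hιP : ιP ≫ Segre.toSpec (Fin (n * m + n + m + 1)) k = P.π := by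
    have h1 : (segreEmbedding n m k).left ≫ Segre.toSpec (Fin (n * m + n + m + 1)) k =
        (projectiveSpace n k ⊗ PS).hom := Over.w (segreEmbedding n m k)
    have h2 : (ιMO ⊗ₘ 𝟙 PS).left ≫ (projectiveSpace n k ⊗ PS).hom = Q.hom := Over.w _
    show (rl.imageι ≫ (ιMO ⊗ₘ 𝟙 PS).left ≫ (segreEmbedding n m k).left) ≫
        Segre.toSpec (Fin (n * m + n + m + 1)) k = rl.imageι ≫ Q.hom
    simp only [Category.assoc]
    rw [h1, h2]
  have hgenP : P.gen ≫ ιP = (ProjectiveSpace.pointOfVec k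
      (fun t => w ((segreIndexEquiv n m).symm t).1 * u ((segreIndexEquiv n m).symm t).2)
      (ProjectiveSpace.segreVec_ne_zero hw hu)).left := by
    have hgM : gM ≫ ιMO = ProjectiveSpace.pointOfVec k w hw := Over.OverMorphism.ext hgenM
    have key := ProjectiveSpace.map_segreEmbedding_lift_pointOfVec (k := k) w hw u hu
    rw [AlgPoints.map_apply, ← hgM] at key
    show rl.toImage ≫ rl.imageι ≫ (ιMO ⊗ₘ 𝟙 PS).left ≫ (segreEmbedding n m k).left = _
    rw [Scheme.Hom.toImage_imageι_assoc, ← key]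
    show rlO.left ≫ (ιMO ⊗ₘ 𝟙 PS).left ≫ (segreEmbedding n m k).left = _
    rw [← Over.comp_left, ← Over.comp_left, lift_map_assoc, Category.comp_id]
  exact ⟨P, φ, ιP, hιPci, hιP, hgenP⟩

end Summit.ResolutionOfSingularities.ResolutionOfSingularities.Theorems
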